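import Literature.NumberTheory.LFunctions.ZetaZeroReciprocalSumsExplicit
import Literature.NumberTheory.LFunctions.ZetaZeroDensityExplicit
import Literature.NumberTheory.LFunctions.ZetaZerosReflection
import HarnessLib

/-!
# RH-FREE — Fiori–Kadiri–Swidinsky 2023, Proposition 3.6: the low part `Σ₀^{σ₁} = 2Σ_{0<γ<T, β<σ₁} x^{β−1}/γ ≤ ε₂(x,σ₁,T₀,T)` of the zero sum for `ψ` («nothing here bears on the truth of RH»)

Topic `Literature/NumberTheory/LFunctions` (RH literature-typing tranche 1, L4 "explicit zero
statistics", gen 5). Label **RH-FREE**. Two definitions (the printed quantities `Σ_a^b` and `ε₂`)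
and THEOREMS; no named facts. Nothing here bears on the truth of RH.

Fiori–Kadiri–Swidinsky, J. Math. Anal. Appl. 527 (2023) 127426 (arXiv:2204.02588v3; item, equation
and table numbers below are those of the compiled arXiv v3, audited 2026-08-27 — theorem-like items
share one counter, so this is **Proposition 3.6**; the declaration name `…_prop32` and the imported
`…_table2`, `recipZeroTable2` keep the labels of an earlier miscount: `prop32` = Prop. 3.6,
`table2` = Table 1), §3.2–3.3:
after the explicit Perron formula (Prop. 3.4) the error `|ψ(x) − x|/x` is controlled by
`2 Σ_{0<γ<T} x^{β−1}/γ = Σ₀^{σ₁} + Σ_{σ₁}^{σ₂} + Σ_{σ₂}^1` (eqs. (3.5)–(3.6),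
`Σ_a^b = 2 Σ_{0<γ<T, a≤β<b} x^{β−1}/γ`, here `FKS2023.zeroSumPsi a b x T` over the tree's window
`0 < γ ≤ T`). **Proposition 3.6** (PROVED here, `FioriKadiriSwidinsky2023_prop32`): for
`σ₁ ∈ (½, 1]`, `(T₀, S₀)` a row of Table 1, `x ≥ 1` and `T ≥ H₀ = 3·10¹²`,

  `Σ₀^{σ₁} ≤ ε₂(x, σ₁, T₀, T) = 2x^{−1/2} (S₀ + B₁(T₀,T)) + (x^{σ₁−1} − x^{−1/2}) B₁(H₀, T)`

(`FKS2023.ε₂`, eq. (3.8)), from: the Table 1 fact `FioriKadiriSwidinsky2023_table2` via Corollary 2.3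
(`FioriKadiriSwidinsky2023_cor23`), Lemma 2.1 (`FioriKadiriSwidinsky2023_lemma21`), the tree's
numerical-RH fact `platt_trudgian_numerical_rh` (zeros with `β > ½` have `γ > 3 000 175 332 800 ≥ H₀`,
the printed "partial verification of the Riemann Hypothesis implies `γ ≥ H₀`"), and the symmetry
of the zeros across `Re s = ½` (`ρ ↦ 1 − ρ̄` preserves ordinates and multiplicities,
`riemannZetaZeroOrder_one_sub_conj`: the printed "for every zero `β + iγ` counted on the left we
also count the symmetric zero `(1−β) + iγ`"), under the zero-counting hypothesis
`|N(t) − L(t)| ≤ b₁ log t + b₂ log log t + b₃` (`t ≥ 2`) of Lemma 2.1 (Remark 2.2: Rosser's or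
Hasanalizade–Shen–Wong's constants). The sum is over the tree's closed window `0 < γ ≤ T`, which
contains the printed `0 < γ < T` (all terms are positive).

## References

* A. Fiori, H. Kadiri, J. Swidinsky, J. Math. Anal. Appl. 527 (2023) 127426 (arXiv:2204.02588v3),
  §3.2 eqs. (3.5)–(3.6), §3.3 Proposition 3.6 eq. (3.8). [FioriKadiriSwidinsky2023]
* D. Platt, T. Trudgian, Bull. Lond. Math. Soc. 53 (2021) 792–797, Thm. 1 (the tree's
  `platt_trudgian_numerical_rh`). [PlattTrudgianBLMS2021]
* E. C. Titchmarsh, *The Theory of the Riemann Zeta-Function*, 2nd ed., §2.12 (symmetry of the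
  zeros). [Titchmarsh1986]
-/

noncomputable section

open Complex Filter Set
open scoped Real ComplexConjugate

namespace Literature.NumberTheory.LFunctions

open SchoenfeldBound

namespace FKS2023

/-- **`Σ_a^b(x, T) = 2 Σ_{0<γ≤T, a ≤ β < b} m(ρ) x^{β−1}/γ`** (eq. (3.5); zeros with multiplicity,
the tree's closed window `γ ≤ T`). [cite: FioriKadiriSwidinsky2023, §3.2 eq. (3.5)] -/
def zeroSumPsi (a b x T : ℝ) : ℝ :=
  2 * ∑ ρ ∈ (zerosBetween 0 T).filter (fun ρ ↦ a ≤ ρ.re ∧ ρ.re < b),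
    (riemannZetaZeroOrder ρ : ℝ) * (x ^ (ρ.re - 1) / ρ.im)

/-- **`ε₂(x, σ₁, T₀, T)`** of eq. (3.8):
`2x^{−1/2}(S₀ + B₁(T₀,T)) + (x^{σ₁−1} − x^{−1/2}) B₁(H₀,T)`, `H₀ = 3·10¹²` (`FKS2023.H₀`), with the
constants `b₁, b₂, b₃` of `B₁` explicit. [cite: FioriKadiriSwidinsky2023, Prop. 3.6 eq. (3.8)] -/
def ε₂ (b₁ b₂ b₃ x σ₁ T₀ S₀ T : ℝ) : ℝ :=
  2 * x ^ (-(1 / 2 : ℝ)) * (S₀ + B₁ b₁ b₂ b₃ T₀ T)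
    + (x ^ (σ₁ - 1) - x ^ (-(1 / 2 : ℝ))) * B₁ b₁ b₂ b₃ H₀ T

/-- Every `T₀` of Table 1 is at most `30 610 046 000 < H₀ = 3·10¹²`.
[cite: FioriKadiriSwidinsky2023, Table 1] -/
theorem le_of_mem_recipZeroTable2 {T₀ S₀ : ℝ} (h : (T₀, S₀) ∈ recipZeroTable2) :
    T₀ ≤ 30610046000 := by
  simp only [recipZeroTable2, List.mem_cons, Prod.mk.injEq, List.not_mem_nil, or_false] at h
  rcases h with ⟨rfl, -⟩ | ⟨rfl, -⟩ | ⟨rfl, -⟩ | ⟨rfl, -⟩ | ⟨rfl, -⟩ | ⟨rfl, -⟩ | ⟨rfl, -⟩ |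
    ⟨rfl, -⟩ | ⟨rfl, -⟩ | ⟨rfl, -⟩ <;> norm_num

end FKS2023

/-! ## The reflection `ρ ↦ 1 − ρ̄` on a window of zeros -/

/-- Under the tree's numerical-RH fact, a zero with `β > ½` (and `Im ρ > 0`) has ordinate
`> 3 000 175 332 800 ≥ H₀ = 3·10¹²` (FKS, proof of Prop. 3.6: "the partial verification of the
Riemann Hypothesis implies `γ ≥ H₀`"). [cite: FioriKadiriSwidinsky2023, Prop. 3.6 (proof)]
[cite: PlattTrudgianBLMS2021, Thm. 1] -/
theorem FKS2023.H₀_le_im_of_half_lt_re (hRH : platt_trudgian_numerical_rh) {ρ : ℂ}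
    (hz : riemannZeta ρ = 0) (him : 0 < ρ.im) (hre : 1 / 2 < ρ.re) : FKS2023.H₀ ≤ ρ.im := by
  by_contra hlt
  have hle : ρ.im ≤ 3000175332800 := by
    have : FKS2023.H₀ = 3 * 10 ^ 12 := rfl
    rw [this] at hlt
    linarith [not_le.1 hlt]
  have := hRH ρ hz him hle
  linarith

/-- **The symmetric zeros**: on a window `0 < γ ≤ T`, the zeros with `½ < β < σ₁ ≤ 1` and
`Im ρ ≥ H` contribute to `Σ m(ρ)/γ` at most half of the contribution of all zeros with `Im ρ ≥ H`
(reflect `ρ ↦ 1 − ρ̄`: same ordinate, same multiplicity, real part `< ½`).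
[cite: FioriKadiriSwidinsky2023, Prop. 3.6 (proof, "the symmetry of zeros across Re s = 1/2")]
[cite: Titchmarsh1986, §2.12] -/
theorem two_mul_sum_inv_half_lt_le {σ₁ H T : ℝ} (hσ₁ : σ₁ ≤ 1) :
    2 * ∑ ρ ∈ (zerosBetween 0 T).filter (fun ρ ↦ (1 / 2 < ρ.re ∧ ρ.re < σ₁) ∧ H ≤ ρ.im),
        (riemannZetaZeroOrder ρ : ℝ) * (1 / ρ.im) ≤
      ∑ ρ ∈ (zerosBetween 0 T).filter (fun ρ ↦ H ≤ ρ.im),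
        (riemannZetaZeroOrder ρ : ℝ) * (1 / ρ.im) := by
  classical
  set Z := zerosBetween 0 T with hZ
  set F := Z.filter (fun ρ ↦ (1 / 2 < ρ.re ∧ ρ.re < σ₁) ∧ H ≤ ρ.im) with hF
  set G := Z.filter (fun ρ ↦ H ≤ ρ.im) with hG
  set r : ℂ → ℂ := fun ρ ↦ 1 - conj ρ with hr
  have hr_im : ∀ ρ, (r ρ).im = ρ.im := fun ρ ↦ by simp [hr]
  have hr_re : ∀ ρ, (r ρ).re = 1 - ρ.re := fun ρ ↦ by simp [hr]
  have hr_inj : Function.Injective r := by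
    intro a b h
    have : 1 - conj (1 - conj a) = 1 - conj (1 - conj b) := by simp only [hr] at h; rw [h]
    simpa using this
  -- members of F: zeros in the open strip with the recorded inequalities
  have hmemF : ∀ ρ ∈ F, riemannZeta ρ = 0 ∧ 0 < ρ.im ∧ ρ.im ≤ T ∧ 1 / 2 < ρ.re ∧ ρ.re < σ₁ ∧
      H ≤ ρ.im := by
    intro ρ hρ
    rw [hF, Finset.mem_filter, hZ, mem_zerosBetween le_rfl] at hρ
    obtain ⟨⟨hz, -, -, h3, h4⟩, ⟨h5, h6⟩, h7⟩ := hρ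
    exact ⟨hz, h3, h4, h5, h6, h7⟩
  -- the reflected zeros lie in G, with real part < 1/2, and have the same multiplicity
  have hrefl : ∀ ρ ∈ F, r ρ ∈ G ∧ (r ρ).re < 1 / 2 ∧
      riemannZetaZeroOrder (r ρ) = riemannZetaZeroOrder ρ := by
    intro ρ hρ
    obtain ⟨hz, him, hT, h5, h6, h7⟩ := hmemF ρ hρ
    have h0 : 0 < ρ.re := by linarith
    have h1 : ρ.re < 1 := by linarith
    have hm : riemannZetaZeroOrder (r ρ) = riemannZetaZeroOrder ρ :=
      riemannZetaZeroOrder_one_sub_conj h0 h1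
    have hρ1 : ρ ≠ 1 := by
      rintro rfl; simp at him
    have hrρ1 : r ρ ≠ 1 := by
      intro h
      have := congrArg Complex.im h
      rw [hr_im] at this
      simp at this
      linarith
    have hzr : riemannZeta (r ρ) = 0 := by
      have hpos : 0 < riemannZetaZeroOrder ρ := (riemannZetaZeroOrder_pos_iff hρ1).2 hz
      rw [← hm] at hpos
      exact (riemannZetaZeroOrder_pos_iff hrρ1).1 hpos
    refine ⟨?_, by rw [hr_re]; linarith, hm⟩
    rw [hG, Finset.mem_filter, hZ, mem_zerosBetween le_rfl, hr_im, hr_re]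
    exact ⟨⟨hzr, by linarith, by linarith, him, hT⟩, h7⟩
  -- F and its image are disjoint subsets of G
  have hFG : F ⊆ G := by
    intro ρ hρ
    rw [hF, Finset.mem_filter] at hρ
    rw [hG, Finset.mem_filter]
    exact ⟨hρ.1, hρ.2.2⟩
  have hIG : F.image r ⊆ G := by
    intro ρ' hρ'
    obtain ⟨ρ, hρ, rfl⟩ := Finset.mem_image.1 hρ'
    exact (hrefl ρ hρ).1
  have hdisj : Disjoint F (F.image r) := by
    rw [Finset.disjoint_left]
    intro ρ hρ hρ'
    obtain ⟨ρ₀, hρ₀, he⟩ := Finset.mem_image.1 hρ'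
    have h1 := (hrefl ρ₀ hρ₀).2.1
    rw [he] at h1
    have h2 := (hmemF ρ hρ).2.2.2.1
    linarith
  -- the sums
  have hsum_image : ∑ ρ ∈ F.image r, (riemannZetaZeroOrder ρ : ℝ) * (1 / ρ.im) =
      ∑ ρ ∈ F, (riemannZetaZeroOrder ρ : ℝ) * (1 / ρ.im) := by
    rw [Finset.sum_image (fun a _ b _ h ↦ hr_inj h)]
    refine Finset.sum_congr rfl fun ρ hρ ↦ ?_
    rw [(hrefl ρ hρ).2.2, hr_im]
  have hnonneg : ∀ ρ ∈ G, 0 ≤ (riemannZetaZeroOrder ρ : ℝ) * (1 / ρ.im) := by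
    intro ρ hρ
    rw [hG, Finset.mem_filter, hZ] at hρ
    have hm := zeroOrder_nonneg_of_mem_zerosBetween le_rfl hρ.1
    obtain ⟨-, -, -, h3, -⟩ := (mem_zerosBetween le_rfl).1 hρ.1
    positivity
  have hunion : ∑ ρ ∈ F ∪ F.image r, (riemannZetaZeroOrder ρ : ℝ) * (1 / ρ.im) ≤
      ∑ ρ ∈ G, (riemannZetaZeroOrder ρ : ℝ) * (1 / ρ.im) :=
    Finset.sum_le_sum_of_subset_of_nonneg (Finset.union_subset hFG hIG) fun ρ hρ _ ↦ hnonneg ρ hρ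
  rw [Finset.sum_union hdisj, hsum_image] at hunion
  linarith

/-! ## Proposition 3.6 -/

/-- **FKS Proposition 3.6** (PROVED): let `σ₁ ∈ (½, 1]`, `(T₀, S₀)` a row of Table 1, `x ≥ 1`,
`T ≥ H₀ = 3·10¹²`, and assume the zero-counting bound `|N(t) − L(t)| ≤ b₁ log t + b₂ log log t + b₃`
for `t ≥ 2` (`b₁, b₂ ≥ 0`) behind `B₁`. Then
`Σ₀^{σ₁}(x,T) = 2Σ_{0<γ≤T, β<σ₁} m(ρ) x^{β−1}/γ ≤ ε₂(x,σ₁,T₀,T)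
 = 2x^{−1/2}(S₀ + B₁(T₀,T)) + (x^{σ₁−1} − x^{−1/2}) B₁(H₀,T)`.
Inputs: Table 1 (named fact), the tree's numerical-RH fact (`β > ½ ⇒ γ > H₀`), Lemma 2.1,
Corollary 2.3, and the reflection `ρ ↦ 1 − ρ̄`. [cite: FioriKadiriSwidinsky2023, Prop. 3.6] -/
theorem FioriKadiriSwidinsky2023_prop32 (hTab : FioriKadiriSwidinsky2023_table2)
    (hRH : platt_trudgian_numerical_rh) {b₁ b₂ b₃ : ℝ} (hb₁ : 0 ≤ b₁) (hb₂ : 0 ≤ b₂)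
    (hR : ∀ t : ℝ, 2 ≤ t → |(zetaZeroCount t : ℝ) - countMain t| ≤ FKS2023.countErr b₁ b₂ b₃ t)
    {T₀ S₀ : ℝ} (hrow : (T₀, S₀) ∈ FKS2023.recipZeroTable2) {σ₁ x T : ℝ} (hσ₁ : 1 / 2 < σ₁)
    (hσ₁' : σ₁ ≤ 1) (hx : 1 ≤ x) (hT : FKS2023.H₀ ≤ T) :
    FKS2023.zeroSumPsi 0 σ₁ x T ≤ FKS2023.ε₂ b₁ b₂ b₃ x σ₁ T₀ S₀ T := by
  classical
  have hπ : π < 3.15 := Real.pi_lt_d2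
  have hH₀ : FKS2023.H₀ = 3 * 10 ^ 12 := rfl
  have hT₀H : T₀ ≤ T := by
    have := FKS2023.le_of_mem_recipZeroTable2 hrow
    rw [hH₀] at hT; linarith
  have hx0 : 0 < x := by linarith
  set Z := zerosBetween 0 T with hZ
  -- abbreviations for the weights
  set w : ℂ → ℝ := fun ρ ↦ (riemannZetaZeroOrder ρ : ℝ) * (1 / ρ.im) with hw
  have hw0 : ∀ ρ ∈ Z, 0 ≤ w ρ := by
    intro ρ hρ
    have hm := zeroOrder_nonneg_of_mem_zerosBetween le_rfl hρ
    obtain ⟨-, -, -, h3, -⟩ := (mem_zerosBetween le_rfl).1 hρ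
    simp only [hw]; positivity
  -- the pieces: F = F₁ ∪ F₂ (β ≤ 1/2, resp. 1/2 < β < σ₁)
  set F := Z.filter (fun ρ ↦ 0 ≤ ρ.re ∧ ρ.re < σ₁) with hF
  set F₁ := F.filter (fun ρ ↦ ρ.re ≤ 1 / 2) with hF₁
  set F₂ := F.filter (fun ρ ↦ ¬ ρ.re ≤ 1 / 2) with hF₂
  -- pointwise bounds on the weights `x^{β−1}`
  have hxpow : ∀ ρ ∈ F, (riemannZetaZeroOrder ρ : ℝ) * (x ^ (ρ.re - 1) / ρ.im) =
      x ^ (ρ.re - 1) * w ρ := by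
    intro ρ _; simp only [hw]; ring
  have hsplit : ∑ ρ ∈ F, (riemannZetaZeroOrder ρ : ℝ) * (x ^ (ρ.re - 1) / ρ.im) =
      ∑ ρ ∈ F₁, x ^ (ρ.re - 1) * w ρ + ∑ ρ ∈ F₂, x ^ (ρ.re - 1) * w ρ := by
    rw [Finset.sum_congr rfl hxpow, hF₁, hF₂, Finset.sum_filter_add_sum_filter_not]
  have hF₁le : ∑ ρ ∈ F₁, x ^ (ρ.re - 1) * w ρ ≤ x ^ (-(1 / 2 : ℝ)) * ∑ ρ ∈ F₁, w ρ := by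
    rw [Finset.mul_sum]
    refine Finset.sum_le_sum fun ρ hρ ↦ ?_
    rw [hF₁, Finset.mem_filter, hF, Finset.mem_filter] at hρ
    refine mul_le_mul_of_nonneg_right ?_ (hw0 ρ hρ.1.1)
    exact Real.rpow_le_rpow_of_exponent_le hx (by linarith [hρ.2])
  have hF₂le : ∑ ρ ∈ F₂, x ^ (ρ.re - 1) * w ρ ≤ x ^ (σ₁ - 1) * ∑ ρ ∈ F₂, w ρ := by
    rw [Finset.mul_sum]
    refine Finset.sum_le_sum fun ρ hρ ↦ ?_
    rw [hF₂, Finset.mem_filter, hF, Finset.mem_filter] at hρ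
    refine mul_le_mul_of_nonneg_right ?_ (hw0 ρ hρ.1.1)
    exact Real.rpow_le_rpow_of_exponent_le hx (by linarith [hρ.1.2.2])
  -- Σ_{F₁} w = Σ_Z w − Σ_{β > 1/2} w ≤ Σ_Z w − Σ_{F₂} w
  set P := Z.filter (fun ρ ↦ 1 / 2 < ρ.re) with hP
  have hF₁eq : F₁ = Z.filter (fun ρ ↦ ¬ (1 / 2 < ρ.re)) := by
    ext ρ
    rw [hF₁, hF, Finset.mem_filter, Finset.mem_filter, Finset.mem_filter, hZ,
      mem_zerosBetween le_rfl]
    constructor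
    · rintro ⟨⟨hz, -⟩, h2⟩; exact ⟨hz, not_lt.2 h2⟩
    · rintro ⟨hz, h2⟩
      exact ⟨⟨hz, hz.2.1, by linarith [not_lt.1 h2]⟩, not_lt.1 h2⟩
  have hZsplit : ∑ ρ ∈ Z, w ρ = ∑ ρ ∈ P, w ρ + ∑ ρ ∈ F₁, w ρ := by
    rw [hF₁eq, hP, Finset.sum_filter_add_sum_filter_not]
  have hF₂P : F₂ ⊆ P := by
    intro ρ hρ
    rw [hF₂, Finset.mem_filter, hF, Finset.mem_filter] at hρ
    rw [hP, Finset.mem_filter]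
    exact ⟨hρ.1.1, not_le.1 hρ.2⟩
  have hAP : ∑ ρ ∈ F₂, w ρ ≤ ∑ ρ ∈ P, w ρ :=
    Finset.sum_le_sum_of_subset_of_nonneg hF₂P fun ρ hρ _ ↦ by
      rw [hP, Finset.mem_filter] at hρ; exact hw0 ρ hρ.1
  -- the zeros of F₂ have γ ≥ H₀; symmetry gives 2 Σ_{F₂} ≤ Σ_{γ ≥ H₀}
  have hF₂eq : F₂ = Z.filter (fun ρ ↦ (1 / 2 < ρ.re ∧ ρ.re < σ₁) ∧ FKS2023.H₀ ≤ ρ.im) := by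
    ext ρ
    rw [hF₂, hF, Finset.mem_filter, Finset.mem_filter, Finset.mem_filter, hZ,
      mem_zerosBetween le_rfl]
    constructor
    · rintro ⟨⟨hz, h0, h1⟩, h2⟩
      have h2' := not_le.1 h2
      exact ⟨hz, ⟨h2', h1⟩, FKS2023.H₀_le_im_of_half_lt_re hRH hz.1 hz.2.2.2.1 h2'⟩
    · rintro ⟨hz, ⟨h2, h1⟩, -⟩
      exact ⟨⟨hz, hz.2.1, h1⟩, not_le.2 h2⟩
  have hsym : 2 * ∑ ρ ∈ F₂, w ρ ≤
      ∑ ρ ∈ Z.filter (fun ρ ↦ FKS2023.H₀ ≤ ρ.im), w ρ := by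
    rw [hF₂eq]
    exact two_mul_sum_inv_half_lt_le (H := FKS2023.H₀) (T := T) hσ₁'
  -- Lemma 2.1 on [H₀, T] and Corollary 2.3 on (0, T]
  have hH2π : 2 * π < FKS2023.H₀ := by rw [hH₀]; linarith
  have hW : ∑ ρ ∈ Z.filter (fun ρ ↦ FKS2023.H₀ ≤ ρ.im), w ρ ≤ FKS2023.B₁ b₁ b₂ b₃ FKS2023.H₀ T :=
    FioriKadiriSwidinsky2023_lemma21 (T₁ := 2) (U₀ := 0) hb₁ hb₂ hR (by linarith) le_rfl hH2π hT
  have hS : ∑ ρ ∈ Z, w ρ < S₀ + FKS2023.B₁ b₁ b₂ b₃ T₀ T :=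
    FioriKadiriSwidinsky2023_cor23 hTab hb₁ hb₂ hR hrow hT₀H
  -- powers of x
  have hxa : 0 < x ^ (-(1 / 2 : ℝ)) := Real.rpow_pos_of_pos hx0 _
  have hxab : x ^ (-(1 / 2 : ℝ)) ≤ x ^ (σ₁ - 1) :=
    Real.rpow_le_rpow_of_exponent_le hx (by linarith)
  -- assemble
  unfold FKS2023.zeroSumPsi FKS2023.ε₂
  rw [← hZ, ← hF, hsplit]
  have hmid : ∑ ρ ∈ F₁, x ^ (ρ.re - 1) * w ρ + ∑ ρ ∈ F₂, x ^ (ρ.re - 1) * w ρ ≤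
      x ^ (-(1 / 2 : ℝ)) * ∑ ρ ∈ Z, w ρ + (x ^ (σ₁ - 1) - x ^ (-(1 / 2 : ℝ))) * ∑ ρ ∈ F₂, w ρ := by
    have h1 : x ^ (-(1 / 2 : ℝ)) * ∑ ρ ∈ F₁, w ρ ≤
        x ^ (-(1 / 2 : ℝ)) * (∑ ρ ∈ Z, w ρ - ∑ ρ ∈ F₂, w ρ) :=
      mul_le_mul_of_nonneg_left (by linarith) hxa.le
    nlinarith [hF₁le, hF₂le, h1]
  have hA0 : 0 ≤ ∑ ρ ∈ F₂, w ρ := Finset.sum_nonneg fun ρ hρ ↦ by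
    rw [hF₂, Finset.mem_filter, hF, Finset.mem_filter] at hρ; exact hw0 ρ hρ.1.1
  have hfin : x ^ (-(1 / 2 : ℝ)) * ∑ ρ ∈ Z, w ρ + (x ^ (σ₁ - 1) - x ^ (-(1 / 2 : ℝ))) * ∑ ρ ∈ F₂, w ρ
      ≤ x ^ (-(1 / 2 : ℝ)) * (S₀ + FKS2023.B₁ b₁ b₂ b₃ T₀ T)
        + (x ^ (σ₁ - 1) - x ^ (-(1 / 2 : ℝ))) * (FKS2023.B₁ b₁ b₂ b₃ FKS2023.H₀ T / 2) := by
    have h1 : x ^ (-(1 / 2 : ℝ)) * ∑ ρ ∈ Z, w ρ ≤ x ^ (-(1 / 2 : ℝ)) * (S₀ + FKS2023.B₁ b₁ b₂ b₃ T₀ T) :=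
      mul_le_mul_of_nonneg_left hS.le hxa.le
    have h2 : (x ^ (σ₁ - 1) - x ^ (-(1 / 2 : ℝ))) * ∑ ρ ∈ F₂, w ρ ≤
        (x ^ (σ₁ - 1) - x ^ (-(1 / 2 : ℝ))) * (FKS2023.B₁ b₁ b₂ b₃ FKS2023.H₀ T / 2) :=
      mul_le_mul_of_nonneg_left (by linarith) (by linarith)
    linarith
  linarith [hmid, hfin]

end Literature.NumberTheory.LFunctions

end
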